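import Literature.NumberTheory.EllipticCurves.TateCurve.TransvectionOfTateParameterNotPower
import Literature.NumberTheory.EllipticCurves.TateCurve.InertiaTorsionOfTateParameterPower
import Summits.BirchSwinnertonDyer.Rank1Residual.X11b.MultiplicativeSurjectivity
import HarnessLib

/-!
# Class X11a — the PRINT route's discharge interface: the NON-SURJECTIVE sub-leaf is LOCALLY SPLIT at
# `p` (the Tate parameter `q_E` is a `p`-th power in `ℚ_p`; no wild inertia on `E[p]`) — REF R4-1 in
# the kernel

Cell `bsd-print-x11a` (D-0131 print tier), seat ty2 (the DISCHARGE INTERFACE), route item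
stmt-BirchSwinnertonDyer-20614 / -20613 (the non-surjective Euler halves `X11aNonSurjMuAnHard{Five,
Three}` live on this sub-leaf). THEOREMS ONLY (no definition, no named fact, no `sorry`); a BOUNDARY
file: nothing here is a class theorem, no pair is booked, the leaf `ClassX11a` stays open.

WHAT. x11c's `X11b/MultiplicativeSurjectivity.lean` proves Serre's *très ramifié* criterion
`Mult ∧ Irr ∧ p ∤ ord_p Δ_min ⟹ Surj` (`surj_of_mult_of_irr_of_not_dvd`: a transvection in the
INERTIA group, Silverman *ATAEC* V.6 Prop. 6.1 at `ℓ = p`, then Serre 1972 Prop. 15). This file is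
its «unit» companion, read through the Tate curve (the tree's DISCHARGED uniformisation, ATAEC V.3.1 /
V.5.3, and the Literature sibling `TateCurve/TransvectionOfTateParameterNotPower.lean`, this seat):

* §1 `GaloisImage.surj_of_mult_of_irr_of_forall_pow_ne_tateParameter` — **`Mult ∧ Irr ∧ q_E ∉ (ℚ_p^×)^p
  ⟹ Surj`** (`p` odd): if the Tate parameter `q ∈ ℚ_p = ℚ_v` of `E` at the multiplicative `p`
  (`q ≠ 0`, `|q|_p < 1`, `j(E_q) = j(E)`) has no `p`-th root in `ℚ_p`, some element of the
  decomposition group at `p` acts on `E[p]` as a transvection `(1 1; 0 1)`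
  (`WeierstrassCurve.exists_transvection_geomTorsion_of_forall_pow_ne_tateParameter`), so `p ∣ #ρ̄(Γ_ℚ)`
  (`dvd_card_map_range_of_transvection`) and an irreducible image of order divisible by `p` with `det`
  onto is `GL₂(𝔽_p)` (Serre Prop. 15, `not_dvd_card_of_not_hasSurjectiveModNGaloisRep`). Since
  `ord_p q = ord_p Δ_min`, `p ∤ ord_p Δ_min ⟹ q ∉ (ℚ_p^×)^p`: §1 CONTAINS the très ramifié criterion
  and adds the peu ramifié pairs whose unit part `u_q` has `u_q^{p−1} ≢ 1 (mod p²)`.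
* §2 `GaloisImage.exists_pow_eq_tateParameter_of_mult_of_irr_of_not_surj` /
  `…exists_tateParameter_pow_…` — contrapositive: **at an odd multiplicative `p` with `E[p]`
  irreducible and `ρ̄_{E,p}` NOT onto, `q_E ∈ (ℚ_p^×)^p`**, i.e. the extension
  `0 → μ_p(⊗δ) → E[p] → ℤ/p(⊗δ) → 0` of `G_{ℚ_p}`-modules SPLITS (its class is the Kummer class of
  `q_E`, ATAEC Ex. 5.13 / the tree's `exists_basis_kummer_galoisRepTorsion_tateCurve`);
  `GaloisImage.smul_geomTorsion_eq_of_mult_of_irr_of_not_surj_of_mem_inertia` — hence (the tree's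
  `smul_geomTorsion_eq_of_mem_inertia_of_pow_eq_tateParameter`, Serre §1.12 Cor. b)) **every inertia
  element at `p` fixing `μ_p` fixes `E[p]`: NO WILD INERTIA acts on `E[p]`**.
* §3 the same on the classes: `ClassX11a.surj_of_forall_pow_ne_tateParameter`,
  **`ClassX11a.exists_pow_eq_tateParameter_of_not_surj`**, `ClassX11a.exists_tateParameter_pow_of_not_surj`,
  `ClassX11a.smul_geomTorsion_eq_of_not_surj_of_mem_inertia`; `ClassX11b.exists_pow_eq_tateParameter_of_not_surj`.

WHY (cell bookkeeping). (i) REF RULING R4-1 (HOME/STATUS 16:55:45Z, REF-AUDIT §F) — «on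
ClassX11a ∧ ¬Surj ∧ split, `q_E ∈ (ℚ_p^×)^p`, so `u_q^{p−1} ≡ 1 (p²)`, `ord_p 𝓛_p(E) ≥ 2 − ord_p v`
and the Greenberg–Stevens exceptional-zero door of `X11a/PrintDischargeMuAn.lean` §1b is VACUOUS there»
— was a pen-and-paper ruling backed by an engine census (kit j284417: 23/23 split ¬Surj pairs @5 have
`u_q⁴ ≡ 1 (25)`); §2/§3 make its premise `q_E ∈ (ℚ_p^×)^p` a KERNEL THEOREM on the whole sub-leaf
(split or not). (ii) PLAN.md §4 candidate line (L4) for the residual U-cruxes 20613/20614 («¬Surj ∧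
Irr ⟹ `E[p]∣_{G_ℚp}` SPLIT (no transvection) ⟹ `p′`-descent …») can import its structural premise by
name. (iii) §1 is a second KERNEL road to the per-pair image bit `Surj W p` (beside x11c's Frobenius
witnesses `GaloisImage.hasSurjectiveModNGaloisRep_of_intModel_of_irr_of_order`) from the single local
datum `q_E ∉ (ℚ_p^×)^p` — e.g. decided by the rational certificate of
`Literature/…/TateParameterNotPthPowerOfJProofs.lean` (`j⁻¹ = p^k·u`, `p² ∤ u^{p−1} − 1`) once the
`ℚ_[p] ≃ ℚ_v` transport of the Tate parameter is spelled out (not done here).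
HONEST FRAMING: boundary theorems; NOT a class theorem; PARTITION currency 0; beyond-print theorem:
no — classical (Serre 1972 §1.11–§1.12 + Prop. 15; Silverman ATAEC V.6.1), new only as a tree theorem.

References: [SilvermanATAEC1994] Thm. V.3.1 (c),(d), Lemma V.5.2 (c), Thm. V.5.3, Prop. V.6.1 and its
proof, Ex. 5.13 (PDF pp. 395–411); [SerreInventiones1972] §1.12 Prop. 13 + Corollaire (p. 277), §2.4
Prop. 15 (p. 280); cell files `X11b/MultiplicativeSurjectivity.lean` (x11c), HOME/REF-AUDIT.md §F (R4-1),
HOME/PLAN.md §4 (L4), HOME/TY2-DISCHARGE-INTERFACE.md §N.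
-/

set_option autoImplicit false

noncomputable section

open scoped Classical NumberField
open IsDedekindDomain Field NumberField
open WeierstrassCurve Literature.NumberTheory.EllipticCurves Literature.NumberTheory.GaloisRepresentations
  Literature.NumberTheory.EllipticCurves.Rank1Residual Literature.NumberTheory.EllipticCurves.TateCurve
  Rat.HeightOneSpectrum

namespace Summit.BirchSwinnertonDyer.Rank1Residual.GaloisImage

variable (W : WeierstrassCurve ℚ) [W.IsElliptic] (p : ℕ) [hp : Fact p.Prime]

/-! ### §1 `Mult ∧ Irr ∧ q_E ∉ (ℚ_p^×)^p ⟹ Surj` -/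

/-- `Mult W p` (prime-indexed) is multiplicative reduction at the place `v` of `𝓞 ℚ` over `p`
(AEC VII.5.1 (b) transported `ℚ_[p] ≃ ℚ_v`, the tree's
`hasMultiplicativeReductionAtPrime_iff_hasMultiplicativeReductionAt_ringOfIntegers`; the three-line
rewrite of `surj_of_mult_of_irr_of_not_dvd`, isolated). [cite: SilvermanAEC2009, VII.5 Prop. 5.1 (b)] -/
theorem hasMultiplicativeReductionAt_of_mult {v : HeightOneSpectrum (𝓞 ℚ)}
    (hv : (primesEquiv v : ℕ) = p) (hmult : Mult W p) : W.HasMultiplicativeReductionAt v := by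
  have hmult' : haveI := Fact.mk (primesEquiv v).2
      W.HasMultiplicativeReductionAtPrime (primesEquiv v) := by
    have key : ∀ (q : ℕ) (hq : Fact q.Prime), q = p →
        @WeierstrassCurve.HasMultiplicativeReductionAtPrime W q hq := by
      rintro q hq rfl; exact hmult
    exact key _ _ hv
  exact (W.hasMultiplicativeReductionAtPrime_iff_hasMultiplicativeReductionAt_ringOfIntegers v).mp hmult'

/-- **`Mult ∧ Irr ∧ q_E ∉ (ℚ_p^×)^p ⟹ Surj` (`p` odd).** For `E/ℚ`, an odd prime `p` of multiplicative
reduction with `E[p]` irreducible, `v` the place of `ℚ` over `p` and `q ∈ ℚ_v` the Tate parameter of `E`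
at `v` (`q ≠ 0`, `|q|_v < 1`, `j(E_q) = j(E)`): if `q` has NO `p`-th root in `ℚ_v`, then `ρ̄_{E,p}` is
onto `GL₂(𝔽_p)`. The decomposition group at `p` contains an element acting on `E[p]` as a transvection
(Silverman's proof of ATAEC Prop. V.6.1 read with «`q ∉ (K^×)^p`» in place of «`p ∤ ord q`», the tree's
`exists_transvection_geomTorsion_of_forall_pow_ne_tateParameter`), so `p ∣ #ρ̄(Γ_ℚ)`
(`dvd_card_map_range_of_transvection`); an irreducible subgroup of `GL₂(𝔽_p)` of order divisible by `p`
with `det` onto is everything (Serre 1972 Prop. 15, `not_dvd_card_of_not_hasSurjectiveModNGaloisRep`).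
Contains x11c's `surj_of_mult_of_irr_of_not_dvd` (`p ∤ ord_p Δ_min = ord_p q ⟹ q ∉ (ℚ_p^×)^p`).
[cite: SilvermanATAEC1994, Prop. V.6.1 and its proof (PDF pp. 410–411)]
[cite: SerreInventiones1972, §1.12 Prop. 13 Corollaire (p. 277), §2.4 Prop. 15 (p. 280)] -/
theorem surj_of_mult_of_irr_of_forall_pow_ne_tateParameter (hp2 : p ≠ 2) (hmult : Mult W p)
    (hirr : Irr W p) {v : HeightOneSpectrum (𝓞 ℚ)} (hv : (primesEquiv v : ℕ) = p)
    {q : v.adicCompletion ℚ} (hq0 : q ≠ 0) (hq : ‖q‖ < 1)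
    (hqj : tateJ q = (W.baseChange (v.adicCompletion ℚ)).j)
    (hnp : ∀ y : v.adicCompletion ℚ, y ^ p ≠ q) : Surj W p := by
  by_contra hns
  obtain ⟨e, Φ, he, -, -, -, -⟩ := exists_frame_galoisRepTorsion_rat W p
  have hG := not_dvd_card_of_not_hasSurjectiveModNGaloisRep W p Φ e he hirr hns
  have hmultv := hasMultiplicativeReductionAt_of_mult W p hv hmult
  obtain ⟨τ, hmove, hunip⟩ :=
    W.exists_transvection_geomTorsion_of_forall_pow_ne_tateParameter hmultv hp.out hp2 hq0 hq hqj hnp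
      (closureEmb (K := ℚ) (v.adicCompletion ℚ))
  exact hG (dvd_card_map_range_of_transvection W p Φ e he hmove hunip)

/-! ### §2 Contrapositive: `¬Surj ⟹ q_E ∈ (ℚ_p^×)^p`, and no wild inertia on `E[p]` -/

/-- **`Mult ∧ Irr ∧ ¬Surj ⟹ q_E ∈ (ℚ_p^×)^p` (`p` odd).** At an odd multiplicative `p` with `E[p]`
irreducible and `ρ̄_{E,p}` NOT onto, the Tate parameter of `E` at `p` is a `p`-th power in `ℚ_p`:
the `G_{ℚ_p}`-extension `E[p]` of `ℤ/p` by `μ_p` (twisted by the unramified quadratic `δ` if non-split)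
is SPLIT — its class is the Kummer class of `q_E` (ATAEC V §3, Ex. 5.13). Contrapositive of §1.
Serre §1.12 Cor.: «il faut et il suffit que `q` ait une racine `p`-ième dans `K_nr`. Noter que cette
condition entraîne `v(j) = −v(q) ≡ 0 (mod p)`» — so in particular `p ∣ ord_p Δ_min`
(x11c's `dvd_padicValInt_of_mult_of_irr_of_not_surj`) AND the unit part `u_q` of `q = p^{ord q}·u_q`
has `u_q^{p−1} ≡ 1 (mod p²)` (REF R4-1's premise, cell `bsd-print-x11a`).
[cite: SilvermanATAEC1994, Prop. V.6.1 and its proof, Ex. 5.13 (PDF pp. 410–411)]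
[cite: SerreInventiones1972, §1.12 Prop. 13 Corollaire (p. 277), §2.4 Prop. 15 (p. 280)] -/
theorem exists_pow_eq_tateParameter_of_mult_of_irr_of_not_surj (hp2 : p ≠ 2) (hmult : Mult W p)
    (hirr : Irr W p) (hns : ¬ Surj W p) {v : HeightOneSpectrum (𝓞 ℚ)} (hv : (primesEquiv v : ℕ) = p)
    {q : v.adicCompletion ℚ} (hq0 : q ≠ 0) (hq : ‖q‖ < 1)
    (hqj : tateJ q = (W.baseChange (v.adicCompletion ℚ)).j) :
    ∃ y : v.adicCompletion ℚ, y ^ p = q := by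
  by_contra h
  exact hns (surj_of_mult_of_irr_of_forall_pow_ne_tateParameter W p hp2 hmult hirr hv hq0 hq hqj
    fun y hy ↦ h ⟨y, hy⟩)

/-- **The Tate parameter at a non-surjective odd multiplicative `p` exists and is a `p`-th power in
`ℚ_p`**: `∃ q y ∈ ℚ_v`, `q ≠ 0`, `|q|_v < 1`, `j(E_q) = j(E)`, `y^p = q` (existence of `q`: ATAEC
Lemma V.5.1 / Thm. V.5.3 (a), the tree's `existsUnique_tateJ_eq_of_one_lt_norm` at `|j|_v > 1`).
[cite: SilvermanATAEC1994, Thm. V.5.3 (a) (PDF pp. 407–408), Prop. V.6.1 (PDF pp. 410–411)]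
[cite: SerreInventiones1972, §1.12 Prop. 13 Corollaire (p. 277), §2.4 Prop. 15 (p. 280)] -/
theorem exists_tateParameter_pow_of_mult_of_irr_of_not_surj (hp2 : p ≠ 2) (hmult : Mult W p)
    (hirr : Irr W p) (hns : ¬ Surj W p) {v : HeightOneSpectrum (𝓞 ℚ)} (hv : (primesEquiv v : ℕ) = p) :
    ∃ q y : v.adicCompletion ℚ, q ≠ 0 ∧ ‖q‖ < 1 ∧
      tateJ q = (W.baseChange (v.adicCompletion ℚ)).j ∧ y ^ p = q := by
  letI := Literature.NumberTheory.GaloisRepresentations.Ultrametric.AdicCompletion.nontriviallyNormedField ℚ v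
  haveI := charZero_adicCompletion' ℚ v
  have hmultv := hasMultiplicativeReductionAt_of_mult W p hv hmult
  have hj := one_lt_norm_j_baseChange_of_hasMultiplicativeReductionAt W v hmultv
  obtain ⟨q, ⟨hq0, hq, hqj⟩, -⟩ := existsUnique_tateJ_eq_of_one_lt_norm hj
  obtain ⟨y, hy⟩ :=
    exists_pow_eq_tateParameter_of_mult_of_irr_of_not_surj W p hp2 hmult hirr hns hv hq0 hq hqj
  exact ⟨q, y, hq0, hq, hqj, hy⟩

open scoped Pointwise in
/-- **No wild inertia on `E[p]` at a non-surjective odd multiplicative `p`.** `E/ℚ`, `p` odd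
multiplicative with `E[p]` irreducible and `ρ̄_{E,p}` not onto, `𝔓 ∣ p` a prime of `\bar ℤ`,
`τ ∈ I_𝔓 ≤ Gal(ℚ̄/ℚ)` fixing every `p`-th root of unity: then `τ` fixes `E[p]` pointwise, i.e.
`ρ̄_{E,p}|_{I_p}` factors through `I_p → Gal(ℚ_p^{nr}(ζ_p)/ℚ_p^{nr})` (order `∣ p − 1`). §2 makes the
Tate parameter a `p`-th power in `ℚ_p`, and then the Kummer cocycle of `q` vanishes (the tree's
`smul_geomTorsion_eq_of_mem_inertia_of_pow_eq_tateParameter`, ATAEC V.3.1 (c),(d) / V.5.3). Serre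
§1.12 Cor. b): «l'image de `I` dans `GL(E_p)` est un groupe cyclique d'ordre `p − 1`».
[cite: SerreInventiones1972, §1.12 Prop. 13 Corollaire b) (p. 277), §2.4 Prop. 15 (p. 280)]
[cite: SilvermanATAEC1994, Thm. V.3.1 (c),(d), Thm. V.5.3, Prop. V.6.1 (PDF pp. 395–411)] -/
theorem smul_geomTorsion_eq_of_mult_of_irr_of_not_surj_of_mem_inertia (hp2 : p ≠ 2)
    (hmult : Mult W p) (hirr : Irr W p) (hns : ¬ Surj W p) {v : HeightOneSpectrum (𝓞 ℚ)}
    (hv : (primesEquiv v : ℕ) = p) {𝔓 : Ideal (absIntegers (𝓞 ℚ) ℚ)} (h𝔓 : 𝔓 ∈ v.primesAbove)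
    {τ : absoluteGaloisGroup ℚ} (hτ : τ ∈ 𝔓.inertia (absoluteGaloisGroup ℚ))
    (hζ : ∀ ζ : AlgebraicClosure ℚ, ζ ^ p = 1 → τ • ζ = ζ) (P : geomTorsion W (p : ℤ)) :
    τ • P = P := by
  obtain ⟨q, y, hq0, hq, hqj, hy⟩ :=
    exists_tateParameter_pow_of_mult_of_irr_of_not_surj W p hp2 hmult hirr hns hv
  exact W.smul_geomTorsion_eq_of_mem_inertia_of_pow_eq_tateParameter
    (hasMultiplicativeReductionAt_of_mult W p hv hmult) hp.out.pos hq0 hq hqj hy h𝔓 hτ hζ P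

end Summit.BirchSwinnertonDyer.Rank1Residual.GaloisImage

/-! ### §3 On the classes X11a (`r_an = 0`) and X11b (`r_an = 1`) -/

namespace Summit.BirchSwinnertonDyer.Rank1Residual

open GaloisImage

variable (W : WeierstrassCurve ℚ) [W.IsElliptic] [W.IsGloballyMinimal] (p : ℕ) [hp : Fact p.Prime]

/-- **X11a: `q_E ∉ (ℚ_p^×)^p ⟹ Surj`** — the image bit of the leaf from ONE local datum (the class
supplies `p ≠ 2`, `Mult`, `Irr`). [cite: SilvermanATAEC1994, Prop. V.6.1 and its proof (PDF pp. 410–411)]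
[cite: SerreInventiones1972, §2.4 Prop. 15 (p. 280)] -/
theorem ClassX11a.surj_of_forall_pow_ne_tateParameter (hX : ClassX11a W p)
    {v : HeightOneSpectrum (𝓞 ℚ)} (hv : (primesEquiv v : ℕ) = p)
    {q : v.adicCompletion ℚ} (hq0 : q ≠ 0) (hq : ‖q‖ < 1)
    (hqj : tateJ q = (W.baseChange (v.adicCompletion ℚ)).j)
    (hnp : ∀ y : v.adicCompletion ℚ, y ^ p ≠ q) : Surj W p :=
  surj_of_mult_of_irr_of_forall_pow_ne_tateParameter W p hX.2.1 hX.2.2.1 hX.2.2.2.1 hv hq0 hq hqj hnp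

/-- **X11a, non-surjective sub-leaf: the Tate parameter is a `p`-th power in `ℚ_p`** (REF R4-1's
premise as a kernel theorem: on `ClassX11a ∧ ¬Surj`, `E[p]∣_{G_{ℚ_p}}` is split; at a SPLIT `p` this
gives `E(ℚ_p)[p] ≠ 0` and `u_q^{p−1} ≡ 1 (mod p²)`, whence the exceptional-zero door of
`X11a/PrintDischargeMuAn.lean` §1b is vacuous there — those two consequences are NOT restated here).
[cite: SilvermanATAEC1994, Prop. V.6.1 and its proof, Ex. 5.13 (PDF pp. 410–411)]
[cite: SerreInventiones1972, §1.12 Prop. 13 Corollaire (p. 277), §2.4 Prop. 15 (p. 280)] -/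
theorem ClassX11a.exists_pow_eq_tateParameter_of_not_surj (hX : ClassX11a W p) (hns : ¬ Surj W p)
    {v : HeightOneSpectrum (𝓞 ℚ)} (hv : (primesEquiv v : ℕ) = p)
    {q : v.adicCompletion ℚ} (hq0 : q ≠ 0) (hq : ‖q‖ < 1)
    (hqj : tateJ q = (W.baseChange (v.adicCompletion ℚ)).j) :
    ∃ y : v.adicCompletion ℚ, y ^ p = q :=
  exists_pow_eq_tateParameter_of_mult_of_irr_of_not_surj W p hX.2.1 hX.2.2.1 hX.2.2.2.1 hns hv hq0
    hq hqj

/-- **X11a, non-surjective sub-leaf: `E` is, at `p`, a twist of a Tate curve `E_q` with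
`q ∈ (ℚ_p^×)^p`** (existence form of the previous theorem).
[cite: SilvermanATAEC1994, Thm. V.5.3 (a), Prop. V.6.1 (PDF pp. 407–411)]
[cite: SerreInventiones1972, §1.12 Prop. 13 Corollaire (p. 277), §2.4 Prop. 15 (p. 280)] -/
theorem ClassX11a.exists_tateParameter_pow_of_not_surj (hX : ClassX11a W p) (hns : ¬ Surj W p)
    {v : HeightOneSpectrum (𝓞 ℚ)} (hv : (primesEquiv v : ℕ) = p) :
    ∃ q y : v.adicCompletion ℚ, q ≠ 0 ∧ ‖q‖ < 1 ∧
      tateJ q = (W.baseChange (v.adicCompletion ℚ)).j ∧ y ^ p = q :=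
  exists_tateParameter_pow_of_mult_of_irr_of_not_surj W p hX.2.1 hX.2.2.1 hX.2.2.2.1 hns hv

open scoped Pointwise in
/-- **X11a, non-surjective sub-leaf: no wild inertia on `E[p]`** — an inertia element at `p` fixing
`μ_p` fixes `E[p]` (Serre §1.12 Cor. b)). [cite: SerreInventiones1972, §1.12 Prop. 13 Corollaire b) (p. 277)]
[cite: SilvermanATAEC1994, Thm. V.3.1 (c),(d), Thm. V.5.3, Prop. V.6.1 (PDF pp. 395–411)] -/
theorem ClassX11a.smul_geomTorsion_eq_of_not_surj_of_mem_inertia (hX : ClassX11a W p)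
    (hns : ¬ Surj W p) {v : HeightOneSpectrum (𝓞 ℚ)} (hv : (primesEquiv v : ℕ) = p)
    {𝔓 : Ideal (absIntegers (𝓞 ℚ) ℚ)} (h𝔓 : 𝔓 ∈ v.primesAbove)
    {τ : absoluteGaloisGroup ℚ} (hτ : τ ∈ 𝔓.inertia (absoluteGaloisGroup ℚ))
    (hζ : ∀ ζ : AlgebraicClosure ℚ, ζ ^ p = 1 → τ • ζ = ζ) (P : geomTorsion W (p : ℤ)) :
    τ • P = P :=
  smul_geomTorsion_eq_of_mult_of_irr_of_not_surj_of_mem_inertia W p hX.2.1 hX.2.2.1 hX.2.2.2.1 hns hv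
    h𝔓 hτ hζ P

omit [W.IsGloballyMinimal] in
/-- **X11b (rank `1` sister class), non-surjective corner: the Tate parameter is a `p`-th power in
`ℚ_p`** — sharpening x11c's `ClassX11b.dvd_and_not_ram_of_not_surj` (`p ∣ ord_p Δ_min`) by the unit
congruence. [cite: SilvermanATAEC1994, Prop. V.6.1 and its proof (PDF pp. 410–411)]
[cite: SerreInventiones1972, §1.12 Prop. 13 Corollaire (p. 277), §2.4 Prop. 15 (p. 280)] -/
theorem ClassX11b.exists_pow_eq_tateParameter_of_not_surj (hX : ClassX11b W p) (hns : ¬ Surj W p)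
    {v : HeightOneSpectrum (𝓞 ℚ)} (hv : (primesEquiv v : ℕ) = p)
    {q : v.adicCompletion ℚ} (hq0 : q ≠ 0) (hq : ‖q‖ < 1)
    (hqj : tateJ q = (W.baseChange (v.adicCompletion ℚ)).j) :
    ∃ y : v.adicCompletion ℚ, y ^ p = q :=
  exists_pow_eq_tateParameter_of_mult_of_irr_of_not_surj W p hX.2.1 hX.2.2.1 hX.2.2.2 hns hv hq0 hq hqj

end Summit.BirchSwinnertonDyer.Rank1Residual

end
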